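import Literature.Analysis.FluidPDE.PassiveScalarProofs
import Literature.Analysis.FluidPDE.PassiveScalarForced
import Literature.Analysis.FluidPDE.PassiveScalarClassicalWeak
import Literature.Analysis.FunctionSpaces.TorusFourierSynthesis
import Literature.Analysis.FunctionSpaces.TorusInverseLaplacianCalculus
import Literature.Analysis.FunctionSpaces.TorusFourierCalculus
import Literature.Analysis.FunctionSpaces.TorusFourierConvolution
import Literature.Analysis.FunctionSpaces.TorusSpectralWeakDerivative
import Literature.Analysis.FunctionSpaces.TorusFirstOrderOps
import Literature.Analysis.FunctionSpaces.TorusFourierModes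
import Literature.Analysis.FunctionSpaces.TorusTrigPoly
import Literature.Analysis.FunctionSpaces.TorusInverseLaplacian
import Literature.Analysis.FluidPDE.EulerReynolds
import Literature.Analysis.FluidPDE.PassiveScalarFourier
import Literature.Analysis.FluidPDE.PassiveScalarEnergyPointwise
import Literature.Analysis.FluidPDE.PassiveScalarEnergyProofs
import Literature.Analysis.FluidPDE.PassiveScalarSpectralBounds
import Literature.Analysis.FluidPDE.LongTimeAverageNonneg
import Literature.Analysis.FunctionSpaces.TorusSobolevNormFacts
import Summits.AnomalousDissipation.AnomalousDissipation.Theorems.ScalarAnomalySteadySourceFormal.Negative.ForcedToolkit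
import Summits.AnomalousDissipation.AnomalousDissipation.Theorems.ScalarAnomalySteadySourceFormal.Negative.ForcedClassicalWeak
import Summits.AnomalousDissipation.AnomalousDissipation.Theorems.ScalarAnomalySteadySourceFormal.Negative.RestFlowSteady
import Summits.AnomalousDissipation.AnomalousDissipation.Theorems.ScalarAnomalySteadySourceFormal.Negative.RestFlowNoGo

/-!
# Negative knowledge for the crux `ScalarAnomalySteadySourceFormal` (stmt-AnomalousDissipation-0448), VI-a: the steady state of the drift equation `c·∇θ = νΔθ + h` by Fourier synthesis

Certified copy of §8 (part 1) of the cdisprove work file: `driftSymbol a_k = 4π²ν|k|² + 2πi k·c`, the coefficients `q_k = 𝓕h(k)/a_k`, their rapid decay, the synthesis `driftState` (smooth, solves the PDE pointwise, classical ⇒ weak forced solution with the constant velocity field), and its Fourier coefficients.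
Supports stmt-AnomalousDissipation-0448.
-/

set_option linter.dupNamespace false

noncomputable section

open scoped BigOperators Topology ENNReal NNReal InnerProductSpace ContDiff
open MeasureTheory Set Filter Function UnitAddTorus Complex

namespace Summit.AnomalousDissipation.AnomalousDissipation.Theorems.ScalarAnomalySteadySourceFormal.Negative

open Literature.Analysis
open Literature.Analysis.FunctionSpaces Literature.Analysis.FunctionSpaces.Torus
open Literature.Analysis.FluidPDE Literature.Analysis.FluidPDE.Torus

variable {d : Type*} [Fintype d] [DecidableEq d]
/-! ### The drift symbol and the steady state of `c·∇θ = νΔθ + h` -/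

/-- The symbol `a_k = 4π²ν|k|² + 2πi (k·c)` of the drift operator `θ ↦ c·∇θ - νΔθ`. [folklore] -/
def driftSymbol (ν : ℝ) (c : EuclideanSpace ℝ d) (k : d → ℤ) : ℂ :=
  ((4 * Real.pi ^ 2 * ν * freqNormSq k : ℝ) : ℂ) + 2 * Real.pi * I * ((∑ i, (k i : ℝ) * c i : ℝ) : ℂ)

omit [DecidableEq d] in
/-- Helper `re_driftSymbol` (see the file docstring). [folklore] -/
theorem re_driftSymbol (ν : ℝ) (c : EuclideanSpace ℝ d) (k : d → ℤ) :
    (driftSymbol ν c k).re = 4 * Real.pi ^ 2 * ν * freqNormSq k := by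
  rw [driftSymbol, Complex.add_re, Complex.ofReal_re]
  simp [Complex.mul_re, Complex.mul_im]

omit [DecidableEq d] in
/-- Helper `le_norm_driftSymbol` (see the file docstring). [folklore] -/
theorem le_norm_driftSymbol (ν : ℝ) (c : EuclideanSpace ℝ d) (k : d → ℤ) :
    4 * Real.pi ^ 2 * ν * freqNormSq k ≤ ‖driftSymbol ν c k‖ := by
  rw [← re_driftSymbol ν c k]
  exact Complex.re_le_norm _

omit [DecidableEq d] in
/-- Helper `driftSymbol_ne_zero` (see the file docstring). [folklore] -/
theorem driftSymbol_ne_zero {ν : ℝ} (hν : 0 < ν) (c : EuclideanSpace ℝ d) {k : d → ℤ} (hk : k ≠ 0) :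
    driftSymbol ν c k ≠ 0 := fun h0 => by
  have h1 := le_norm_driftSymbol ν c k
  rw [h0, norm_zero] at h1
  have h2 := lt_of_lt_of_le one_pos (one_le_freqNormSq_of_ne_zero hk)
  have : 0 < 4 * Real.pi ^ 2 * ν * freqNormSq k := by positivity
  linarith

/-- The Fourier coefficients `q_k = 𝓕h(k)/a_k` (`k ≠ 0`), `q_0 = 0`, of the steady drift state. [folklore] -/
def driftCoeff (ν : ℝ) (c : EuclideanSpace ℝ d) (h : UnitAddTorus d → ℝ) (k : d → ℤ) : ℂ :=
  if k = 0 then 0 else mFourierCoeff (fun x => (h x : ℂ)) k / driftSymbol ν c k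

omit [DecidableEq d] in
/-- Helper `norm_driftCoeff_le` (see the file docstring). [folklore] -/
theorem norm_driftCoeff_le {ν : ℝ} (hν : 0 < ν) (c : EuclideanSpace ℝ d) (h : UnitAddTorus d → ℝ)
    {k : d → ℤ} (hk : k ≠ 0) :
    ‖driftCoeff ν c h k‖ ≤ ‖mFourierCoeff (fun x => (h x : ℂ)) k‖ / (4 * Real.pi ^ 2 * ν * freqNormSq k) := by
  rw [driftCoeff, if_neg hk, norm_div]
  have h2 := lt_of_lt_of_le one_pos (one_le_freqNormSq_of_ne_zero hk)
  exact div_le_div_of_nonneg_left (norm_nonneg _) (by positivity) (le_norm_driftSymbol ν c k)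

omit [DecidableEq d] in
/-- Helper `norm_driftCoeff_le'` (see the file docstring). [folklore] -/
theorem norm_driftCoeff_le' {ν : ℝ} (hν : 0 < ν) (c : EuclideanSpace ℝ d) (h : UnitAddTorus d → ℝ)
    (k : d → ℤ) :
    ‖driftCoeff ν c h k‖ ≤ (4 * Real.pi ^ 2 * ν)⁻¹ * ‖mFourierCoeff (fun x => (h x : ℂ)) k‖ := by
  by_cases hk : k = 0
  · rw [driftCoeff, if_pos hk, norm_zero]; positivity
  · refine (norm_driftCoeff_le hν c h hk).trans ?_
    have h2 := one_le_freqNormSq_of_ne_zero hk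
    rw [div_eq_inv_mul]
    refine mul_le_mul_of_nonneg_right ?_ (norm_nonneg _)
    rw [inv_le_inv₀ (by positivity) (by positivity)]
    nlinarith [Real.pi_pos, mul_pos (mul_pos (by norm_num : (0:ℝ) < 4) (pow_pos Real.pi_pos 2)) hν]

/-- Helper `rapidDecay_driftCoeff` (see the file docstring). [folklore] -/
theorem rapidDecay_driftCoeff {ν : ℝ} (hν : 0 < ν) (c : EuclideanSpace ℝ d) {h : UnitAddTorus d → ℝ}
    (hh : IsSmooth h) : RapidDecay (driftCoeff ν c h) :=
  (hh.ofReal.rapidDecay_mFourierCoeff).of_norm_le_mul fun k => norm_driftCoeff_le' hν c h k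

/-- The complex steady drift state `F = ∑_k e_k q_k`. [folklore] -/
def driftStateC (ν : ℝ) (c : EuclideanSpace ℝ d) (h : UnitAddTorus d → ℝ) : UnitAddTorus d → ℂ :=
  fourierSynth (driftCoeff ν c h)

/-- **The steady drift state** `θ_p = Re ∑_k e_k 𝓕h(k)/(4π²ν|k|² + 2πi k·c)`: the smooth solution of
`c·∇θ_p = νΔθ_p + h` for a smooth mean-zero source. [folklore] -/
def driftState (ν : ℝ) (c : EuclideanSpace ℝ d) (h : UnitAddTorus d → ℝ) : UnitAddTorus d → ℝ :=
  fun x => (driftStateC ν c h x).re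

/-- Helper `isSmooth_driftStateC` (see the file docstring). [folklore] -/
theorem isSmooth_driftStateC {ν : ℝ} (hν : 0 < ν) (c : EuclideanSpace ℝ d) {h : UnitAddTorus d → ℝ}
    (hh : IsSmooth h) : IsSmooth (driftStateC ν c h) :=
  (rapidDecay_driftCoeff hν c hh).isSmooth_fourierSynth

/-- Helper `isSmooth_driftState` (see the file docstring). [folklore] -/
theorem isSmooth_driftState {ν : ℝ} (hν : 0 < ν) (c : EuclideanSpace ℝ d) {h : UnitAddTorus d → ℝ}
    (hh : IsSmooth h) : IsSmooth (driftState ν c h) :=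
  (isSmooth_driftStateC hν c hh).comp_clm Complex.reCLM

/-- Helper `mFourierCoeff_driftStateC` (see the file docstring). [folklore] -/
theorem mFourierCoeff_driftStateC {ν : ℝ} (hν : 0 < ν) (c : EuclideanSpace ℝ d) {h : UnitAddTorus d → ℝ}
    (hh : IsSmooth h) (k : d → ℤ) : mFourierCoeff (driftStateC ν c h) k = driftCoeff ν c h k :=
  (rapidDecay_driftCoeff hν c hh).mFourierCoeff_fourierSynth k

/-- **Symbol calculus**: for smooth `Φ : T^d → ℂ`,
`𝓕(∑ⱼ cⱼ ∂ⱼΦ - νΔΦ)(k) = a_k 𝓕Φ(k)`. [folklore] -/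
theorem mFourierCoeff_driftOp {ν : ℝ} (c : EuclideanSpace ℝ d) {Φ : UnitAddTorus d → ℂ} (hΦ : IsSmooth Φ)
    (k : d → ℤ) :
    mFourierCoeff (fun x => ∑ j, (c j : ℂ) * partialDeriv j Φ x - (ν : ℂ) * laplacian Φ x) k =
      driftSymbol ν c k * mFourierCoeff Φ k := by
  have hint : ∀ j, Integrable (fun x => (c j : ℂ) * partialDeriv j Φ x) volume :=
    fun j => (hΦ.partialDeriv j).integrable.const_mul _
  have e1 : (fun x => ∑ j, (c j : ℂ) * partialDeriv j Φ x - (ν : ℂ) * laplacian Φ x) =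
      (fun x => ∑ j, (c j : ℂ) * partialDeriv j Φ x) - fun x => (ν : ℂ) * laplacian Φ x := rfl
  rw [e1, mFourierCoeff_sub (integrable_finsetSum _ fun j _ => hint j) (hΦ.laplacian.integrable.const_mul _),
    mFourierCoeff_finset_sum _ (fun j _ => hint j)]
  have e2 : ∀ j, mFourierCoeff (fun x => (c j : ℂ) * partialDeriv j Φ x) k =
      (c j : ℂ) * ((2 * Real.pi * Complex.I * (k j)) * mFourierCoeff Φ k) := fun j => by
    rw [show (fun x => (c j : ℂ) * partialDeriv j Φ x) = (c j : ℂ) • partialDeriv j Φ from rfl,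
      mFourierCoeff_const_smul, mFourierCoeff_partialDeriv hΦ j k, smul_eq_mul, smul_eq_mul]
  have e3 : mFourierCoeff (fun x => (ν : ℂ) * laplacian Φ x) k =
      (ν : ℂ) * (-(4 * Real.pi ^ 2 * freqNormSq k : ℝ) * mFourierCoeff Φ k) := by
    rw [show (fun x => (ν : ℂ) * laplacian Φ x) = (ν : ℂ) • laplacian Φ from rfl,
      mFourierCoeff_const_smul, mFourierCoeff_laplacian_complex hΦ k, smul_eq_mul]
  simp_rw [e2]
  rw [e3, driftSymbol]
  push_cast
  have hs : ∑ j, (c j : ℂ) * (2 * Real.pi * I * (k j : ℂ) * mFourierCoeff Φ k) =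
      2 * Real.pi * I * (∑ j, (k j : ℂ) * (c j : ℂ)) * mFourierCoeff Φ k := by
    rw [Finset.mul_sum, Finset.sum_mul]
    exact Finset.sum_congr rfl fun j _ => by ring
  rw [hs]
  ring

omit [DecidableEq d] in
/-- `𝓕h(0) = 0` for a mean-zero real `h`. [folklore] -/
theorem mFourierCoeff_zero_of_hasZeroMean {h : UnitAddTorus d → ℝ} (hmean : HasZeroMean h) :
    mFourierCoeff (fun x => (h x : ℂ)) 0 = 0 := by
  rw [mFourierCoeff_eq_integral_conj_mul]
  simp only [mFourier_zero, ContinuousMap.one_apply, map_one, one_mul]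
  rw [integral_complex_ofReal, hmean, Complex.ofReal_zero]

omit [DecidableEq d] in
/-- `a_k q_k = 𝓕h(k)` for every `k` (mean-zero `h`). [folklore] -/
theorem driftSymbol_mul_driftCoeff {ν : ℝ} (hν : 0 < ν) (c : EuclideanSpace ℝ d) {h : UnitAddTorus d → ℝ}
    (hmean : HasZeroMean h) (k : d → ℤ) :
    driftSymbol ν c k * driftCoeff ν c h k = mFourierCoeff (fun x => (h x : ℂ)) k := by
  by_cases hk : k = 0
  · subst hk
    rw [driftCoeff, if_pos rfl, mul_zero, mFourierCoeff_zero_of_hasZeroMean hmean]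
  · rw [driftCoeff, if_neg hk, mul_div_cancel₀ _ (driftSymbol_ne_zero hν c hk)]

/-- **The complex drift state solves the complex PDE** `∑ⱼ cⱼ ∂ⱼF - νΔF = h`. [folklore] -/
theorem driftStateC_pde {ν : ℝ} (hν : 0 < ν) (c : EuclideanSpace ℝ d) {h : UnitAddTorus d → ℝ}
    (hh : IsSmooth h) (hmean : HasZeroMean h) :
    (fun x => ∑ j, (c j : ℂ) * partialDeriv j (driftStateC ν c h) x - (ν : ℂ) * laplacian (driftStateC ν c h) x) =
      fun x => (h x : ℂ) := by
  have hF := isSmooth_driftStateC hν c hh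
  have hG : IsSmooth (fun x => ∑ j, (c j : ℂ) * partialDeriv j (driftStateC ν c h) x -
      (ν : ℂ) * laplacian (driftStateC ν c h) x) := by
    have e : (fun x => ∑ j, (c j : ℂ) * partialDeriv j (driftStateC ν c h) x -
        (ν : ℂ) * laplacian (driftStateC ν c h) x) =
        (∑ j, (c j) • partialDeriv j (driftStateC ν c h)) - ν • laplacian (driftStateC ν c h) := by
      funext x
      simp only [Pi.sub_apply, Finset.sum_apply, Pi.smul_apply, Complex.real_smul]
    rw [e]
    exact (isSmooth_finset_sum _ fun j _ => (hF.partialDeriv j).smul (c j)).sub (hF.laplacian.smul ν)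
  refine IsSmooth.ext_mFourierCoeff hG hh.ofReal fun k => ?_
  rw [mFourierCoeff_driftOp c hF k, mFourierCoeff_driftStateC hν c hh k, driftSymbol_mul_driftCoeff hν c hmean k]

/-- **The steady drift state solves `c·∇θ_p = νΔθ_p + h` pointwise.** [folklore] -/
theorem driftState_pde {ν : ℝ} (hν : 0 < ν) (c : EuclideanSpace ℝ d) {h : UnitAddTorus d → ℝ}
    (hh : IsSmooth h) (hmean : HasZeroMean h) (x : UnitAddTorus d) :
    ⟪c, gradient (driftState ν c h) x⟫_ℝ = ν * laplacian (driftState ν c h) x + h x := by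
  have hF := isSmooth_driftStateC hν c hh
  have hθ := isSmooth_driftState hν c hh
  have hpde := congrFun (driftStateC_pde hν c hh hmean) x
  simp only at hpde
  have e1 : driftState ν c h = Complex.reCLM ∘ driftStateC ν c h := rfl
  rw [inner_gradient_eq_sum_mul_partialDeriv (hθ.isContDiff (by simp)), e1]
  simp_rw [partialDeriv_clm_comp hF Complex.reCLM]
  rw [laplacian_clm_comp_apply hF Complex.reCLM x]
  simp only [Complex.reCLM_apply]
  have h2 : ∑ j, c j * (partialDeriv j (driftStateC ν c h) x).re =
      (∑ j, (c j : ℂ) * partialDeriv j (driftStateC ν c h) x).re := by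
    rw [Complex.re_sum]
    refine Finset.sum_congr rfl fun j _ => ?_
    rw [Complex.re_ofReal_mul]
  have hA : (∑ j, (c j : ℂ) * partialDeriv j (driftStateC ν c h) x) =
      (h x : ℂ) + (ν : ℂ) * laplacian (driftStateC ν c h) x := by
    rw [← hpde]; ring
  rw [h2, hA, Complex.add_re, Complex.ofReal_re, Complex.re_ofReal_mul]
  ring

/-! ### The drift state as a classical and weak solution; its Fourier coefficients -/

/-- Constant vector fields are divergence free. [folklore] -/
theorem isDivFree_constField (cv : EuclideanSpace ℝ d) : IsDivFree (fun _ : UnitAddTorus d => cv) := by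
  classical
  intro x
  simp [FunctionSpaces.Torus.divergence, FunctionSpaces.Torus.partialDeriv, FunctionSpaces.Torus.lineDeriv]

/-- The steady drift state is a classical steady solution of the forced equation with the constant
velocity field `c`. [folklore] -/
theorem driftState_isClassical {ν : ℝ} (hν : 0 < ν) (c : EuclideanSpace ℝ d) {h : UnitAddTorus d → ℝ}
    (hh : IsSmooth h) (hmean : HasZeroMean h) :
    IsClassicalScalarTransportForcedOn univ ν (fun (_ : ℝ) (_ : UnitAddTorus d) => c)
      (fun _ => h) (fun _ => driftState ν c h) where
  smooth_velocity := contDiffOn_const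
  smooth_source := isSmoothSpaceTimeOn_const hh univ
  smooth_scalar := isSmoothSpaceTimeOn_const (isSmooth_driftState hν c hh) univ
  transport := fun t _ x => by
    have h0 : FunctionSpaces.Torus.timeDerivWithin univ (fun (_ : ℝ) => driftState ν c h) t x = 0 := by
      simp [FunctionSpaces.Torus.timeDerivWithin]
    rw [h0, zero_add, driftState_pde hν c hh hmean x]
  divFree := fun _ _ => isDivFree_constField c

/-- … hence a global weak solution with datum itself. [folklore] -/
theorem driftState_isWeak {ν : ℝ} (hν : 0 < ν) (c : EuclideanSpace ℝ d) {h : UnitAddTorus d → ℝ}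
    (hh : IsSmooth h) (hmean : HasZeroMean h) :
    IsWeakScalarTransportForced ν (fun (_ : ℝ) (_ : UnitAddTorus d) => c) (fun _ => h)
      (driftState ν c h) (fun _ => driftState ν c h) :=
  isWeakScalarTransportForced_of_classical (driftState_isClassical hν c hh hmean)

/-- **Fourier coefficients of the (real) drift state**: `a_k 𝓕θ_p(k) = 𝓕h(k)` (from the PDE,
complexified), hence `𝓕θ_p(k) = q_k` for `k ≠ 0`. [folklore] -/
theorem driftSymbol_mul_mFourierCoeff_driftState {ν : ℝ} (hν : 0 < ν) (c : EuclideanSpace ℝ d)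
    {h : UnitAddTorus d → ℝ} (hh : IsSmooth h) (hmean : HasZeroMean h) (k : d → ℤ) :
    driftSymbol ν c k * mFourierCoeff (fun x => (driftState ν c h x : ℂ)) k = mFourierCoeff (fun x => (h x : ℂ)) k := by
  have hθ := isSmooth_driftState hν c hh
  have hΘ : IsSmooth (fun x => (driftState ν c h x : ℂ)) := hθ.ofReal
  -- the complexified real PDE
  have hpde : (fun x => ∑ j, (c j : ℂ) * partialDeriv j (fun y => (driftState ν c h y : ℂ)) x -
      (ν : ℂ) * laplacian (fun y => (driftState ν c h y : ℂ)) x) = fun x => (h x : ℂ) := by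
    funext x
    have hr := driftState_pde hν c hh hmean x
    rw [inner_gradient_eq_sum_mul_partialDeriv (hθ.isContDiff (by simp))] at hr
    simp_rw [partialDeriv_ofReal_comp hθ]
    rw [← ofReal_laplacian hθ x]
    have := congrArg (fun r : ℝ => (r : ℂ)) hr
    simp only at this
    push_cast at this
    linear_combination this
  have := mFourierCoeff_driftOp (ν := ν) c hΘ k
  rw [hpde] at this
  exact this.symm

/-- Helper `mFourierCoeff_driftState` (see the file docstring). [folklore] -/
theorem mFourierCoeff_driftState {ν : ℝ} (hν : 0 < ν) (c : EuclideanSpace ℝ d)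
    {h : UnitAddTorus d → ℝ} (hh : IsSmooth h) (hmean : HasZeroMean h) {k : d → ℤ} (hk : k ≠ 0) :
    mFourierCoeff (fun x => (driftState ν c h x : ℂ)) k = driftCoeff ν c h k := by
  have h1 := driftSymbol_mul_mFourierCoeff_driftState hν c hh hmean k
  have ha := driftSymbol_ne_zero hν c hk
  rw [driftCoeff, if_neg hk, eq_div_iff ha, mul_comm]
  exact h1


end Summit.AnomalousDissipation.AnomalousDissipation.Theorems.ScalarAnomalySteadySourceFormal.Negative
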